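import Literature.NumberTheory.EllipticCurves.Rank1Residual.Predicates
import Literature.NumberTheory.EllipticCurves.QuadraticTwistProofs
import Literature.NumberTheory.EllipticCurves.QuadraticTwistJInvariantProofs
import Literature.NumberTheory.EllipticCurves.CyclotomicIwasawaMainTheoremIrreducibleBaseChangeProofs
import Literature.NumberTheory.EllipticCurves.ComplexMultiplicationHasCMProofs
import Literature.NumberTheory.EllipticCurves.LFunctionSmulProofs
import Literature.NumberTheory.EllipticCurves.LeadingTermBSZOrdinaryProofs
import Literature.NumberTheory.EllipticCurves.ModularityVersionApProofs
import Literature.NumberTheory.EllipticCurves.BSDSelmerSmithRootNumberDensityProofs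
import Literature.NumberTheory.EllipticCurves.SerreOpenImageOrdinaryInertiaProofs
import HarnessLib

/-!
# Route `RamifiedHeegnerPair`, support item `RamifiedTwistSupply` (stmt-BirchSwinnertonDyer-23194):
# stub `stub_transport` of the line `supply-imaginary-pair` — transport back to the Gss2 curve

The checked skeleton `Cruxes/RamifiedPairLowerBound/SupplyViaImaginaryPair.lean` (planner
bsd-trib-w-rhp g3, commit abe3e481245d) reduces the support item `RamifiedTwistSupply` to five stubs.
This file proves the fifth one, `stub_transport`, VERBATIM: for `V₀ = C • W^{(−3)}` globally minimal and
good supersingular at `3`, `W` non-CM, and `m > 0` squarefree with `3 ∤ m`, the integer `d = −3m` is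
negative, squarefree, with `v₃(d) = 1`, and a globally minimal model `V` of `V₀^{(m)}` (Silverman VIII.8.3,
`exists_isGloballyMinimal_smul_eq_quadraticTwist`) is `ℚ`-isomorphic to `W^{(d)}`
(`(C • W^{(−3)})^{(m)} = (u, m r, 0, 0) • W^{(−3m)}`, `quadraticTwist_smul` + `quadraticTwist_quadraticTwist`),
is non-CM (`j(V) = j(V₀) = j(W)`, `hasCM_iff_of_j_eq`), has GOOD SUPERSINGULAR reduction at `3` (good:
the conductor of a twist by the `3`-unit `m` stays prime to `3`, `not_dvd_conductorNorm_quadraticTwist_of_not_dvd`;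
supersingular: `a₃(V) = (m/3)·a₃(V₀)`, `frobeniusTrace_quadraticTwist_holds`), and
`r_an(V) = r_an(V₀^{(m)})` (`analyticRank_smul`).

Prover bsd-wall-utd-p3 g8 (cross-route utility inside W-ALL row 2·3@3), 2026-08-28. BSD is not proved by
any of this.
-/

noncomputable section

set_option linter.dupNamespace false

open WeierstrassCurve Literature.NumberTheory.EllipticCurves
  Literature.NumberTheory.EllipticCurves.Rank1Residual

namespace Summit.BirchSwinnertonDyer.BirchSwinnertonDyer.Theorems.RamifiedTwistSupplyStubs

/-- `j` is constant on a `ℚ`-isomorphism class, in the shape `C • A = B` (Silverman III.1.4(b); Mathlib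
`variableChange_j`). [folklore] -/
theorem j_eq_of_smul_eq {A B : WeierstrassCurve ℚ} [A.IsElliptic] [B.IsElliptic]
    (C : VariableChange ℚ) (h : C • A = B) : A.j = B.j := by
  subst h
  exact (A.variableChange_j C).symm

/-- The analytic rank is constant on a `ℚ`-isomorphism class, in the shape `C • A = B`
(`analyticRank_smul`). [folklore] -/
theorem analyticRank_eq_of_smul_eq {A B : WeierstrassCurve ℚ} [A.IsElliptic] [B.IsElliptic]
    (C : VariableChange ℚ) (h : C • A = B) : A.analyticRank = B.analyticRank := by
  subst h
  exact (analyticRank_smul A C).symm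

/-- **Stub `stub_transport` of `Cruxes/RamifiedPairLowerBound/SupplyViaImaginaryPair.lean`, verbatim
signature.** For `m > 0` squarefree with `3 ∤ m`: `d = −3m` has `d < 0`, `v₃(d) = 1`, `d` squarefree;
`W^{(d)} ≅ (V₀^{(−3)})^{(−3m)}`-wise, a globally minimal model `V` of `V₀^{(m)}` is `ℚ`-isomorphic to
`W^{(d)}`, is non-CM, has good supersingular reduction at `3`, and `r_an(V) = r_an(V₀^{(m)})`.
[cite: SilvermanAEC2009, VIII.8.3, VII.5 Prop. 5.1 and X.5 Cor. 5.4.1] [cite: Knapp1993, Prop. 12.10] -/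
theorem transport (W : WeierstrassCurve ℚ) [W.IsElliptic] [W.IsGloballyMinimal]
    (V₀ : WeierstrassCurve ℚ) [V₀.IsElliptic] [V₀.IsGloballyMinimal] (C : VariableChange ℚ)
    (hC : C • W.quadraticTwist (-3) = V₀) (hss : GoodSS V₀ 3) (hCM : ¬ W.HasCM)
    (m : ℤ) (hm : 0 < m) (hsq : Squarefree m) (h3 : ¬ (3 : ℤ) ∣ m) :
    ∃ (V : WeierstrassCurve ℚ) (_ : V.IsElliptic) (_ : V.IsGloballyMinimal),
      (-3 * m : ℤ) < 0 ∧ padicValInt 3 (-3 * m) = 1 ∧ Squarefree (-3 * m : ℤ) ∧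
      (∃ C' : VariableChange ℚ, C' • W.quadraticTwist ((-3 * m : ℤ) : ℚ) = V) ∧
      ¬ V.HasCM ∧ GoodSS V 3 ∧ V.analyticRank = (V₀.quadraticTwist (m : ℚ)).analyticRank := by
  haveI : NeZero (2 : ℚ) := ⟨two_ne_zero⟩
  have hm0 : (m : ℚ) ≠ 0 := by exact_mod_cast hm.ne'
  haveI hEm : (V₀.quadraticTwist (m : ℚ)).IsElliptic := V₀.isElliptic_quadraticTwist hm0
  haveI hE3 : (W.quadraticTwist (-3)).IsElliptic := W.isElliptic_quadraticTwist (by norm_num)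
  have hmabs : m.natAbs ≠ 0 := Int.natAbs_ne_zero.mpr hm.ne'
  have h3abs : ¬ 3 ∣ m.natAbs := fun h ↦ h3 (Int.natCast_dvd.mpr h)
  have habs : (-3 * m : ℤ).natAbs = 3 * m.natAbs := by
    rw [Int.natAbs_mul, Int.natAbs_neg]; rfl
  -- a globally minimal model `V` of `V₀^{(m)}`
  obtain ⟨V, hVE, hVM, Cm, hCm⟩ := exists_isGloballyMinimal_smul_eq_quadraticTwist V₀ hm0
  refine ⟨V, hVE, hVM, by omega, ?_, ?_, ?_, ?_, ?_, analyticRank_eq_of_smul_eq Cm hCm⟩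
  · -- `v₃(−3m) = 1`
    rw [padicValInt, habs, padicValNat.mul (by norm_num) hmabs, padicValNat_self,
      padicValNat.eq_zero_of_not_dvd h3abs]
  · -- `−3m` squarefree
    rw [← Int.squarefree_natAbs, habs]
    exact (Nat.squarefree_mul ((Nat.Prime.coprime_iff_not_dvd Nat.prime_three).mpr h3abs)).mpr
      ⟨Nat.prime_three.prime.squarefree, Int.squarefree_natAbs.mpr hsq⟩
  · -- `V ≅ W^{(−3m)}` over `ℚ`
    refine ⟨Cm⁻¹ * ⟨C.u, (m : ℚ) * C.r, 0, 0⟩, ?_⟩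
    have hcast : ((-3 * m : ℤ) : ℚ) = (-3 : ℚ) * (m : ℚ) := by push_cast; ring
    rw [hcast, ← quadraticTwist_quadraticTwist, mul_smul, ← WeierstrassCurve.quadraticTwist_smul, hC,
      ← hCm, inv_smul_smul]
  · -- non-CM: `j(V) = j(V₀^{(m)}) = j(V₀) = j(W^{(−3)}) = j(W)`
    have hj : V.j = W.j := by
      rw [j_eq_of_smul_eq Cm hCm, V₀.j_quadraticTwist hm0, ← j_eq_of_smul_eq C hC,
        W.j_quadraticTwist (by norm_num)]
    exact fun h ↦ hCM ((hasCM_iff_of_j_eq hj).mp h)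
  · -- good supersingular at `3`
    have hN0 : ¬ 3 ∣ V₀.conductorNorm ℤ :=
      fun h ↦ (V₀.dvd_conductorNorm_iff_not_hasGoodReductionAtPrime 3).mp h hss.1
    have hNm : ¬ 3 ∣ (V₀.quadraticTwist (m : ℚ)).conductorNorm ℤ :=
      not_dvd_conductorNorm_quadraticTwist_of_not_dvd V₀ Nat.prime_three (by decide) hN0 hm.ne' h3
    have hgoodm : (V₀.quadraticTwist (m : ℚ)).HasGoodReductionAtPrime 3 := by
      by_contra h
      exact hNm (((V₀.quadraticTwist (m : ℚ)).dvd_conductorNorm_iff_not_hasGoodReductionAtPrime 3).mpr h)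
    have hgoodV : V.HasGoodReductionAtPrime 3 := by
      rw [← hCm] at hgoodm
      exact (BSZLemma17.hasGoodReductionAtPrime_smul_iff V Cm 3).mp hgoodm
    have hΔ : ¬ ((3 : ℕ) : ℤ) ∣ V₀.minimalDiscriminantInt :=
      V₀.not_dvd_minimalDiscriminantInt_of_hasGoodReductionAtPrime' 3 hss.1
    have h2m : ¬ ((3 : ℕ) : ℤ) ∣ 2 * m := fun h ↦
      (Int.prime_three.dvd_or_dvd h).elim (by decide) h3
    have htr : V.frobeniusTrace 3 = legendreSym 3 m * V₀.frobeniusTrace 3 :=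
      frobeniusTrace_quadraticTwist_holds V₀ V m hsq ⟨Cm, hCm⟩ 3 h2m hΔ
    refine ⟨hgoodV, ?_⟩
    rw [htr]
    exact hss.2.mul_left _

end Summit.BirchSwinnertonDyer.BirchSwinnertonDyer.Theorems.RamifiedTwistSupplyStubs

end
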